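/-
Origin: expansion seat `planner-pub-hodgecm-qw8-g11-0`, handover #14 SPLIT PART 1/2 of tree `HodgeCM/Model/Toy/LefTypes.lean` 794160ff (488 l. > 400-line cap) = NEW module `HodgeCM.Model.Toy.LefTypesBasic` md5 0f771a66364cc565a89506c764aad45a (311 l.): verbatim section-boundary slice + docstrings; imports: NO rewrite (tree imports only: Mathlib, HodgeCM.Model.Toy.ExteriorHodge, HodgeCM.Model.Toy.GaloisClosure, HodgeCM.Model.Toy.StarObj); check-wip LANDABLE rc 0 (`HOME/pub-hodgecm-qw8-g11/lean/Qw8g11/LefTypesBasic.lean`, md5 0f771a66, 311 lines);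
landed by the packager successor (mc-unitary-1-g3, gen-8 kit) in gate run 32 as `HodgeCM/Model/Toy/LefTypesBasic.lean` (verbatim).
-/
-- HANDOVER (planner-pub-hodgecm-qw8-g11-0, unit pub-hodgecm-qw8-g11): SPLIT PART 1/2 of the installed
-- `HodgeCM.Model.Toy.LefTypes` (md5 794160ff, 488 l.; 400-line cap, lean/CONVENTIONS.md) = its ll. 39–281 (`Qbar`, `Gam`,
-- lifting + Galois action, eigen-coordinates, type counts, `balSpan`/`unbSpan`) verbatim + docstrings; WIP module
-- `Qw8g11.LefTypesBasic`, intended final module `HodgeCM.Model.Toy.LefTypesBasic` (NEW file; tree imports only, NO rewrite).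
/-
Copyright: HodgeCMPerL expansion cell, seat pub-hodgecm-qw8-g5 ([QW8] §2.5 lineage, gen 5).
-/
import Mathlib
import Summits.HodgeConjecture.HodgeCM.Model.Toy.ExteriorHodge
import Summits.HodgeConjecture.HodgeCM.Model.Toy.GaloisClosure
import Summits.HodgeConjecture.HodgeCM.Model.Toy.StarObj

/-!
# Galois types of eigen-indices, type counts and the balanced-type spans

Split part 1/2 of `HodgeCM.Model.Toy.LefTypes` (unchanged content). For an object `X` of the exterior toy universe
(`HodgeCM.Model.Toy`), every eigen-index `s = (i, τ)` (`τ : F_i →+* ℂ` an embedding of the atom field) has a **Galois type**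
`typ s = {γ ∈ Aut_ℚ(ℚ̄) | γ ∘ τ ∈ Φ_i} ⊆ Γ`, `ℚ̄ = algebraicClosure ℚ ℂ` (`Qbar`), `Γ = (ℚ̄ ≃ₐ[ℚ] ℚ̄)` (`Gam`).
The **link lemma** (`typ_eq_of_coefQ_ne_zero`): if the eigen-coordinate of a Hodge `ℚ`-linear map `φ_ℂ (e_t)` at `e_s` is
nonzero then `typ s = typ t` — the coordinate is an algebraic number `ĉ_{s,t}(φ) ∈ ℚ̄` (explicit trace-dual-basis formula
`coefQ`), Galois-equivariant (`coefQ_gact`). An index map `g : Fin k → Idx X` is **balanced** (`Bal`) when for every `T ⊆ Γ`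
the number of entries of type `T` (`tcnt`) equals the number of entries of type `Tᶜ`; `balSpan X k` / `unbSpan X k` are the
spans of the balanced / unbalanced eigen-monomials (`balSpan_sup_unbSpan`). Their disjointness, the wedge basis of balanced
index SETS, multiplicativity and naturality are in `HodgeCM.Model.Toy.LefTypes`. Pure (multi)linear algebra over the
eigenbasis of `HodgeCM.Model.Toy.EigenBasis`; no Hodge datum is involved.
-/

noncomputable section

/- `IsAlgClosure ℚ (algebraicClosure ℚ ℂ)` (hence `Normal ℚ ℚ̄`) is registered for the intermediate field's own
`ℚ`-algebra structure; as in `HodgeCM.Model.Inhabited` the instance is only found with the pre-4.32 transparency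
behaviour of unification. -/
set_option backward.isDefEq.respectTransparency false

open TensorProduct exteriorPower Module

namespace HodgeCM.Toy

/-- the field of algebraic numbers, presented inside `ℂ` -/
abbrev Qbar : IntermediateField ℚ ℂ := algebraicClosure ℚ ℂ

/-- `Γ = Aut_ℚ(ℚ̄)` -/
abbrev Gam : Type := (Qbar ≃ₐ[ℚ] Qbar)

namespace Obj

variable (X : Obj)

/-! ### Lifting eigen-indices to `ℚ̄` and the Galois action -/

/-- every value `τ x` of the embedding of an eigen-index `s = (i, τ)` is an algebraic number (`∈
ℚ̄`) -/
lemma apply_mem_Qbar (s : X.Idx) (x : (X.atom s.1).F) : s.2 x ∈ Qbar := by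
  show s.2 x ∈ algebraicClosure ℚ ℂ
  rw [mem_algebraicClosure_iff]
  have hx : IsAlgebraic ℚ x := Algebra.IsAlgebraic.isAlgebraic x
  exact hx.algHom s.2.toRatAlgHom

/-- the embedding `τ = s.2` with values in `ℚ̄` -/
def liftE (s : X.Idx) : (X.atom s.1).F →+* Qbar := (s.2).codRestrict Qbar (X.apply_mem_Qbar s)

/-- the `ℚ̄`-valued lift `liftE s` agrees with the embedding `s.2` after the coercion `ℚ̄ → ℂ` -/
@[simp] lemma coe_liftE (s : X.Idx) (x : (X.atom s.1).F) : ((X.liftE s x : Qbar) : ℂ) = s.2 x := rfl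

/-- the Galois action on eigen-indices: `γ • (i, τ) = (i, γ ∘ τ)` -/
def gact (γ : Gam) (s : X.Idx) : X.Idx :=
  ⟨s.1, (algebraMap Qbar ℂ).comp (γ.toRingEquiv.toRingHom.comp (X.liftE s))⟩

/-- the Galois action on eigen-indices preserves the atom: `(γ • s).1 = s.1` -/
@[simp] lemma gact_fst (γ : Gam) (s : X.Idx) : (X.gact γ s).1 = s.1 := rfl

/-- the embedding of `γ • s` is `γ ∘ (lift of s.2)`, read in `ℂ` -/
lemma gact_snd_apply (γ : Gam) (s : X.Idx) (x : (X.atom s.1).F) :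
    (X.gact γ s).2 x = ((γ (X.liftE s x) : Qbar) : ℂ) := rfl

/-- the lift of the twisted index `γ • s` is `γ ∘ liftE s` (as ring maps into `ℚ̄`) -/
lemma liftE_gact (γ : Gam) (s : X.Idx) :
    X.liftE (X.gact γ s) = γ.toRingEquiv.toRingHom.comp (X.liftE s) :=
  RingHom.ext fun _ => Subtype.ext rfl

/-- pointwise form of `liftE_gact` -/
lemma liftE_gact_apply (γ : Gam) (s : X.Idx) (x : (X.atom s.1).F) :
    X.liftE (X.gact γ s) x = γ (X.liftE s x) := by
  rw [liftE_gact]; rfl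

/-- the **Galois type** of an eigen-index: the automorphisms moving it into the CM type -/
def typ (s : X.Idx) : Set Gam := {γ | X.hol (X.gact γ s)}

/-- `γ ∈ typ s` iff the twisted index `γ • s` is holomorphic (definitional) -/
lemma mem_typ (s : X.Idx) (γ : Gam) : γ ∈ X.typ s ↔ X.hol (X.gact γ s) := Iff.rfl

/-- complex conjugation as an element of `Γ` -/
def kap : Gam := GaloisClosure.conjQ.restrictNormal Qbar

/-- `κ` acts on `ℚ̄ ⊂ ℂ` as complex conjugation -/
lemma coe_kap (x : Qbar) : ((kap x : Qbar) : ℂ) = starRingEnd ℂ (x : ℂ) :=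
  AlgEquiv.restrictNormal_commutes GaloisClosure.conjQ Qbar x

/-- twisting an eigen-index by `κ` is the conjugate index `X.bar s` -/
lemma gact_kap (s : X.Idx) : X.gact kap s = X.bar s := by
  refine Sigma.ext rfl (heq_of_eq (RingHom.ext fun x => ?_))
  show ((kap (X.liftE s x) : Qbar) : ℂ) = NumberField.ComplexEmbedding.conjugate s.2 x
  rw [coe_kap, NumberField.ComplexEmbedding.conjugate_coe_eq, coe_liftE]

/-! ### Eigen-coordinates of rational vectors -/

/-- `1 ⊗ x ∈ ℂ ⊗_ℚ F_i` expands in the eigenbasis of the atom with coordinates `τ x`, `τ : F_i →+*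
ℂ` -/
lemma one_tmul_atom_eq_sum (i : X.s.toType) (x : (X.atom i).F) :
    ((1 : ℂ) ⊗ₜ[ℚ] x : ℂ ⊗[ℚ] (X.atom i).F) = ∑ τ : (X.atom i).F →+* ℂ, τ x • eps (X.atom i).F τ := by
  have h : ((1 : ℂ) ⊗ₜ[ℚ] x : ℂ ⊗[ℚ] (X.atom i).F) = ((1 : ℂ) ⊗ₜ[ℚ] x) * 1 := (mul_one _).symm
  rw [h, ← sum_eps, Finset.mul_sum]
  exact Finset.sum_congr rfl fun τ _ => tmul_mul_eps τ x

/-- **eigen-expansion of a rational vector**: `1 ⊗ ℓ = Σ_s s.2(ℓ_{s.1}) · e_s` -/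
lemma one_tmul_eq_sum (ℓ : X.L) : ((1 : ℂ) ⊗ₜ[ℚ] ℓ : X.LC) = ∑ s : X.Idx, s.2 (ℓ s.1) • X.eB s := by
  classical
  have hsig : ∑ s : X.Idx, s.2 (ℓ s.1) • X.eB s
      = ∑ i : X.s.toType, ∑ τ : (X.atom i).F →+* ℂ, τ (ℓ i) • X.eB ⟨i, τ⟩ := by
    rw [← Finset.univ_sigma_univ, Finset.sum_sigma]
  rw [hsig]
  conv_lhs => rw [← Finset.univ_sum_single ℓ]
  rw [TensorProduct.tmul_sum]
  refine Finset.sum_congr rfl fun i _ => ?_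
  have h1 : ((1 : ℂ) ⊗ₜ[ℚ] (Pi.single i (ℓ i) : X.L) : X.LC)
      = (LinearMap.single ℚ (fun j => ((X.atom j).F : Type)) i).baseChange ℂ ((1 : ℂ) ⊗ₜ[ℚ] ℓ i) := by
    rw [LinearMap.baseChange_tmul, LinearMap.coe_single]
  rw [h1, one_tmul_atom_eq_sum, map_sum]
  refine Finset.sum_congr rfl fun τ _ => ?_
  rw [map_smul, eB_apply]
  rfl

/-- the eigen-coordinate of a rational vector `1 ⊗ ℓ` at the index `s = (i, τ)` is `τ (ℓ i)` -/
lemma repr_one_tmul (ℓ : X.L) (s : X.Idx) : X.eB.repr ((1 : ℂ) ⊗ₜ[ℚ] ℓ) s = s.2 (ℓ s.1) := by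
  have h : X.eB.equivFun.symm (fun s : X.Idx => s.2 (ℓ s.1)) = ((1 : ℂ) ⊗ₜ[ℚ] ℓ : X.LC) := by
    rw [Basis.equivFun_symm_apply]
    exact (X.one_tmul_eq_sum ℓ).symm
  have h2 := congrArg (fun v => X.eB.equivFun v s) h
  simp only [LinearEquiv.apply_symm_apply, Basis.equivFun_apply] at h2
  exact h2.symm

variable {X} {Y : Obj}

/-- **the algebraic coordinate** `ĉ_{s,t}(φ) = Σ_m t̂(d_m) · ŝ((φ v_{t,m})_{s.1}) ∈ ℚ̄` of `φ_ℂ(e_t)` at `e_s` -/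
def coefQ (φ : Y.L →ₗ[ℚ] X.L) (s : X.Idx) (t : Y.Idx) : Qbar :=
  ∑ m, Y.liftE t (dF (Y.atom t.1).F m) * X.liftE s ((φ (Y.vec t m)) s.1)

/-- **coordinate formula**: the `e_s`-coordinate of `φ_ℂ (e_t)` is the algebraic number `ĉ_{s,t}(φ)`. -/
theorem repr_baseChange_eB (φ : Y.L →ₗ[ℚ] X.L) (s : X.Idx) (t : Y.Idx) :
    X.eB.repr (φ.baseChange ℂ (Y.eB t)) s = (coefQ φ s t : ℂ) := by
  rw [Y.eB_expand t, map_sum, map_sum, Finsupp.coe_finsetSum, Finset.sum_apply, coefQ,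
    IntermediateField.coe_sum]
  refine Finset.sum_congr rfl fun m _ => ?_
  rw [map_smul, LinearMap.baseChange_tmul, map_smul, Finsupp.smul_apply, repr_one_tmul, smul_eq_mul,
    IntermediateField.coe_mul, coe_liftE, coe_liftE]
  rfl

/-- **Galois equivariance** of the algebraic coordinates. -/
theorem coefQ_gact (φ : Y.L →ₗ[ℚ] X.L) (γ : Gam) (s : X.Idx) (t : Y.Idx) :
    coefQ φ (X.gact γ s) (Y.gact γ t) = γ (coefQ φ s t) := by
  unfold coefQ
  rw [map_sum]
  refine Finset.sum_congr rfl fun m _ => ?_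
  rw [map_mul, liftE_gact_apply, liftE_gact_apply]
  rfl

/-- Hodge maps have no coordinate from a holomorphic to a non-holomorphic index. -/
lemma coefQ_eq_zero_of_hol (f : Hom X Y) {s : X.Idx} {t : Y.Idx} (ht : Y.hol t) (hs : ¬ X.hol s) :
    coefQ f.lin s t = 0 := by
  have hmem : f.lin.baseChange ℂ (Y.eB t) ∈ X.F1 := by
    rw [eB_apply']
    exact (isHodge_iff f.lin).mp f.hodge t.1 t.2 ht
  have h0 := X.repr_eq_zero_of_mem_F1 hmem hs
  rw [repr_baseChange_eB] at h0
  exact_mod_cast h0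

/-- **Hodge symmetry of links**: a nonzero coordinate links indices of the same holomorphy. -/
theorem hol_iff_of_coefQ_ne_zero (f : Hom X Y) {s : X.Idx} {t : Y.Idx} (h : coefQ f.lin s t ≠ 0) :
    (X.hol s ↔ Y.hol t) := by
  constructor
  · intro hs
    by_contra ht
    have ht' : Y.hol (Y.bar t) := (Y.hol_bar_iff t).mpr ht
    have h' : coefQ f.lin (X.gact kap s) (Y.gact kap t) ≠ 0 := by
      rw [coefQ_gact]
      exact (EmbeddingLike.map_ne_zero_iff).mpr h
    rw [gact_kap, gact_kap] at h'
    by_cases hbs : X.hol (X.bar s)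
    · exact (X.hol_bar_iff s).mp hbs hs
    · exact h' (coefQ_eq_zero_of_hol f ht' hbs)
  · intro ht
    by_contra hs
    exact h (coefQ_eq_zero_of_hol f ht hs)

/-- **Link lemma**: a nonzero coordinate of a Hodge map links indices of the same Galois type. -/
theorem typ_eq_of_coefQ_ne_zero (f : Hom X Y) {s : X.Idx} {t : Y.Idx} (h : coefQ f.lin s t ≠ 0) :
    X.typ s = Y.typ t := by
  ext γ
  rw [mem_typ, mem_typ]
  have hγ : coefQ f.lin (X.gact γ s) (Y.gact γ t) ≠ 0 := by
    rw [coefQ_gact]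
    exact (EmbeddingLike.map_ne_zero_iff).mpr h
  exact hol_iff_of_coefQ_ne_zero f hγ

/-- atoms with a complex conjugation have complementary types at conjugate indices -/
theorem typ_bar_of_conj {X : Obj} (s : X.Idx) (c : (X.atom s.1).F →+* (X.atom s.1).F)
    (hc : ∀ (τ : (X.atom s.1).F →+* ℂ) (x : (X.atom s.1).F), τ (c x) = starRingEnd ℂ (τ x)) :
    X.typ (X.bar s) = (X.typ s)ᶜ := by
  have hlift : ∀ x, X.liftE (X.bar s) x = X.liftE s (c x) := fun x => Subtype.ext (by
    change NumberField.ComplexEmbedding.conjugate s.2 x = s.2 (c x)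
    rw [NumberField.ComplexEmbedding.conjugate_coe_eq, hc])
  have hg : ∀ γ : Gam, X.gact γ (X.bar s) = X.bar (X.gact γ s) := fun γ => by
    refine Sigma.ext rfl (heq_of_eq (RingHom.ext fun x => ?_))
    change ((γ (X.liftE (X.bar s) x) : Qbar) : ℂ) = NumberField.ComplexEmbedding.conjugate (X.gact γ s).2 x
    rw [hlift, NumberField.ComplexEmbedding.conjugate_coe_eq]
    exact hc (X.gact γ s).2 x
  ext γ
  rw [mem_typ, Set.mem_compl_iff, mem_typ, hg, hol_bar_iff]

variable (X)

/-! ### Type counts and balanced index maps -/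

/-- the slots of an index map carrying a given Galois type (classical decidability, fixed once) -/
def tslots {k : ℕ} (g : Fin k → X.Idx) (T : Set Gam) : Finset (Fin k) :=
  @Finset.filter _ (fun j => X.typ (g j) = T) (fun _ => Classical.propDecidable _) Finset.univ

/-- slot `j` is counted in `tslots g T` iff the index `g j` has Galois type `T` -/
lemma mem_tslots {k : ℕ} (g : Fin k → X.Idx) (T : Set Gam) (j : Fin k) :
    j ∈ X.tslots g T ↔ X.typ (g j) = T := by
  simp only [tslots, Finset.mem_filter, Finset.mem_univ, true_and]

/-- the number of entries of an index map of Galois type `T` -/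
def tcnt {k : ℕ} (g : Fin k → X.Idx) (T : Set Gam) : ℕ := (X.tslots g T).card

/-- `tcnt g T` as a `Finset.filter` cardinality, for any decidability instance -/
lemma tcnt_eq_card_filter {k : ℕ} (g : Fin k → X.Idx) (T : Set Gam) [DecidablePred fun j => X.typ (g j) = T] :
    X.tcnt g T = (Finset.univ.filter fun j => X.typ (g j) = T).card := by
  unfold tcnt
  congr 1
  ext j
  rw [mem_tslots, Finset.mem_filter]
  simp

/-- type counts are additive under concatenation of index maps -/
lemma tcnt_append {k l : ℕ} (g : Fin k → X.Idx) (g' : Fin l → X.Idx) (T : Set Gam) :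
    X.tcnt (Fin.append g g') T = X.tcnt g T + X.tcnt g' T := by
  classical
  rw [tcnt_eq_card_filter, tcnt_eq_card_filter, tcnt_eq_card_filter,
    Finset.card_filter, Finset.card_filter, Finset.card_filter, Fin.sum_univ_add]
  simp

variable {X} in
/-- index maps with slotwise equal Galois types (possibly in different objects) have equal type
counts -/
lemma tcnt_congr {k : ℕ} {g : Fin k → X.Idx} {g' : Fin k → Y.Idx} (h : ∀ j, X.typ (g j) = Y.typ (g' j))
    (T : Set Gam) : X.tcnt g T = Y.tcnt g' T := by
  classical
  rw [tcnt_eq_card_filter, tcnt_eq_card_filter]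
  congr 1
  exact Finset.filter_congr fun j _ => by rw [h j]

/-- **balanced** index maps: every Galois type occurs as often as its complement -/
def Bal {k : ℕ} (g : Fin k → X.Idx) : Prop := ∀ T : Set Gam, X.tcnt g T = X.tcnt g Tᶜ

/-- the concatenation of two balanced index maps is balanced -/
lemma bal_append {k l : ℕ} {g : Fin k → X.Idx} {g' : Fin l → X.Idx} (hg : X.Bal g) (hg' : X.Bal g') :
    X.Bal (Fin.append g g') := fun T => by
  rw [tcnt_append, tcnt_append, hg T, hg' T]

/-- if `g ++ g'` and `g'` are balanced then so is `g` -/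
lemma bal_of_append {k l : ℕ} {g : Fin k → X.Idx} {g' : Fin l → X.Idx} (h : X.Bal (Fin.append g g'))
    (hg' : X.Bal g') : X.Bal g := fun T => by
  have h1 := h T
  rw [tcnt_append, tcnt_append, hg' T] at h1
  omega

/-- an unbalanced map concatenated with a balanced one is unbalanced -/
lemma not_bal_append {k l : ℕ} {g : Fin k → X.Idx} {g' : Fin l → X.Idx} (hg : ¬ X.Bal g) (hg' : X.Bal g') :
    ¬ X.Bal (Fin.append g g') := fun h => hg (X.bal_of_append h hg')

/-- `balSpan k = ⟨mono g | g balanced⟩` -/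
def balSpan (k : ℕ) : Submodule ℂ (⋀[ℂ]^k X.LC) :=
  Submodule.span ℂ {x | ∃ g : Fin k → X.Idx, X.Bal g ∧ x = X.mono k g}

/-- `unbSpan k = ⟨mono g | g unbalanced⟩` -/
def unbSpan (k : ℕ) : Submodule ℂ (⋀[ℂ]^k X.LC) :=
  Submodule.span ℂ {x | ∃ g : Fin k → X.Idx, ¬ X.Bal g ∧ x = X.mono k g}

/-- the eigen-monomial of a balanced index map lies in `balSpan` -/
lemma mono_mem_balSpan {k : ℕ} {g : Fin k → X.Idx} (h : X.Bal g) : X.mono k g ∈ X.balSpan k :=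
  Submodule.subset_span ⟨g, h, rfl⟩

/-- the eigen-monomial of an unbalanced index map lies in `unbSpan` -/
lemma mono_mem_unbSpan {k : ℕ} {g : Fin k → X.Idx} (h : ¬ X.Bal g) : X.mono k g ∈ X.unbSpan k :=
  Submodule.subset_span ⟨g, h, rfl⟩

/-- `balSpan k` and `unbSpan k` together span `⋀^k X.LC` (every eigen-monomial is balanced or
unbalanced) -/
lemma balSpan_sup_unbSpan (k : ℕ) : X.balSpan k ⊔ X.unbSpan k = ⊤ := by
  rw [eq_top_iff, ← span_mono_eq_top, Submodule.span_le]
  rintro _ ⟨g, rfl⟩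
  by_cases h : X.Bal g
  · exact Submodule.mem_sup_left (X.mono_mem_balSpan h)
  · exact Submodule.mem_sup_right (X.mono_mem_unbSpan h)

end Obj

end HodgeCM.Toy

end
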